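import Literature.NumberTheory.LFunctions.JensenXiLadderBox
import HarnessLib

/-!
# Moment enclosures on a finite stretch of shifts: the hypothesis shape and the `δ₁`-range lemma

Between the per-shift sign certificates (small `n`) and the analytic ladder tail (`n ≥ N_box(d)`,
`JensenXiLadderBox*.lean`) the Jensen track certifies `J^{d,n}_ξ` on a FINITE STRETCH `a ≤ n ≤ b` by
ONE (or a few) box sign certificates whose box is the hull of certified enclosures of the moment
vector `(μ₂(n), …, μ_{2d}(n))` over the stretch (engine data; the enclosures themselves are certified
NUMERICS, not kernel facts). This file fixes the vocabulary:

* `xiMuMoments d n = [μ₂(n), μ₃(n), …, μ_{2d}(n)]` (the parameter vector `xiMuVec d n` without its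
  first entry `δ₁(n)`; `xiMuVec_eq_cons`);
* `XiMomentsInBox d a b B` — the ENCLOSURE HYPOTHESIS "for every `a ≤ n ≤ b` the moment vector lies
  in the rational box `B`";
* `ipMem_deltaOne_of_range` — the `δ₁`-coordinate is free of hypotheses: `δ₁(n) = (2n+1)^{-1/2} ∈
  [lo, hi]` for `a ≤ n ≤ b` as soon as `lo²(2b+1) ≤ 1 ≤ hi²(2a+1)` (decidable on `ℚ`);
* `boxMem_xiMuVec_of_range` — so `XiMomentsInBox d a b B` puts `xiMuVec d n` in `(lo, hi) :: B`, the
  box a kernel certificate `MGPolyCertifies gorzPoly_dM ((lo, hi) :: B) d u` is about.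

## References
* [GORZPNAS2019] Griffin–Ono–Rolen–Zagier, PNAS 116 (2019), Thm. 3, §5.1 eq. (15), (18), §5.2.
* [Moore1979] R. E. Moore, *Methods and Applications of Interval Analysis*, SIAM 1979, Ch. 3, Thm. 3.1.
-/

open Polynomial Finset

namespace Literature.NumberTheory.LFunctions

/-- The moment part `[μ₂(n), μ₃(n), …, μ_{2d}(n)]` of the degree-`d` parameter vector.
[cite: GORZPNAS2019, §5.1 eq. (15)] -/
noncomputable def xiMuMoments (d n : ℕ) : List ℝ :=
  xiMu n 2 :: xiMuTail n 3 (2 * d - 2)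

/-- `xiMuVec d n = δ₁(n) :: xiMuMoments d n`. [cite: GORZPNAS2019, §5.1 eq. (15)] -/
theorem xiMuVec_eq_cons (d n : ℕ) : xiMuVec d n = deltaOne n :: xiMuMoments d n := rfl

/-- **Enclosure hypothesis on a stretch:** for every `a ≤ n ≤ b` the moment vector
`(μ₂(n), …, μ_{2d}(n))` lies in the rational box `B` (certified numerics of the moments of
`u^{2n}Φ(u)du` — a HYPOTHESIS in this tree, like the coefficient enclosures of
`JensenShiftCertificate.lean`). [cite: GORZPNAS2019, §5.2] -/
def XiMomentsInBox (d a b : ℕ) (B : List (ℚ × ℚ)) : Prop :=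
  ∀ n : ℕ, a ≤ n → n ≤ b → BoxMem B (xiMuMoments d n)

/-- **The `δ₁`-coordinate on a stretch:** `δ₁(n) ∈ [lo, hi]` for `a ≤ n ≤ b` whenever `0 ≤ lo`,
`0 ≤ hi`, `lo²(2b+1) ≤ 1 ≤ hi²(2a+1)` (`δ₁(n)² = 1/(2n+1)`). [cite: GORZPNAS2019, §5.1 eq. (18)] -/
theorem ipMem_deltaOne_of_range {a b n : ℕ} {lo hi : ℚ} (hlo : 0 ≤ lo) (hhi : 0 ≤ hi)
    (h1 : lo ^ 2 * (2 * b + 1) ≤ 1) (h2 : 1 ≤ hi ^ 2 * (2 * a + 1)) (ha : a ≤ n) (hb : n ≤ b) :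
    IPMem (lo, hi) (deltaOne n) := by
  have hsq : deltaOne n ^ 2 = 1 / (2 * n + 1) := by
    rw [deltaOne_sq, GORZAsymp.yseq]; field_simp
  have hpos := (deltaOne_pos n).le
  have hb' : (n : ℝ) ≤ b := by exact_mod_cast hb
  have h1' : (lo : ℝ) ^ 2 * (2 * b + 1) ≤ 1 := by exact_mod_cast h1
  refine ⟨?_, deltaOne_le_of_le hhi h2 ha⟩
  have hlo2 : ((lo : ℚ) : ℝ) ^ 2 ≤ deltaOne n ^ 2 := by
    rw [hsq, le_div_iff₀ (by positivity)]; nlinarith [sq_nonneg (lo : ℝ)]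
  exact (pow_le_pow_iff_left₀ (by exact_mod_cast hlo) hpos two_ne_zero).1 hlo2

/-- An enclosure of the moments plus the free `δ₁`-range give the full parameter vector in the
product box. [cite: Moore1979, Ch. 3, Thm. 3.1] -/
theorem boxMem_xiMuVec_of_range {d a b n : ℕ} {lo hi : ℚ} {B : List (ℚ × ℚ)}
    (hδ : IPMem (lo, hi) (deltaOne n)) (hB : XiMomentsInBox d a b B) (ha : a ≤ n) (hb : n ≤ b) :
    BoxMem ((lo, hi) :: B) (xiMuVec d n) :=
  List.Forall₂.cons hδ (hB n ha hb)

end Literature.NumberTheory.LFunctions
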